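import Mathlib
import HarnessLib
import Literature.Analysis.FluidPDE.Tao2016AveragedNS.LocalCascadeSolutions
import Literature.Analysis.FluidPDE.Tao2016AveragedNS.RenormalisedCascadeWaves
import Literature.Analysis.FluidPDE.Tao2016AveragedNS.WeightedLatticeFlows
import Summits.NavierStokesRegularity.NavierStokesRegularity.Theorems.TaoLadderRungTwoBreakEternalRigidityViscBddOneDefs
import Summits.NavierStokesRegularity.NavierStokesRegularity.Theorems.TaoLadderRungTwoBreakEternalRigidityViscBddOneCriticalBKM

/-!
# Crux `TaoLadderRungTwoBreak.EternalRigidityViscBddOne` (stmt-NavierStokesRegularity-20420): the MINIMAL BLOW-UP RATE of the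
# viscous lattice — `sup_{i,k} Λ^k|X_{i,k}(t)|·(t⋆−t) ≥ 1/(16(3+Λ))` along every viscous blow-up (part 3/3; remaining lemma (I) of the
# (ω4) census: the REGULARITY CRITERION IN THE CRITICAL NORM)

MODEL lattice ODEs only (Tao 2016 §4: the exact NS-scaled `ν`-viscous cascade lattice of a table of `InTableClass R`, `m = 4`, from a
one-shell datum, in the registered vocabulary `ViscousUpTo` / `BlowsUpAt` / `TypeOne` of the skeleton `85fbfe8e90eea58b`); nothing here
is a statement about the Navier–Stokes equations; no stub, crux or summit is closed (`--supports stmt-NavierStokesRegularity-20420`).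

The (ω4) stub `stub_eternalLimitViscBdd` extracts an ω-limit of the renormalised trajectory `W_n(σ) = Λ^n e^{−σ} X_n(t⋆ − e^{−σ})` of a
type-I viscous blow-up; TYPE I is the UPPER bound `sup_n ‖W_n(σ)‖ ≤ C`.  This file proves the complementary LOWER bound for EVERY
viscous blow-up (no type-I hypothesis), i.e. the lattice form of Leray's minimal blow-up rate / the regularity criterion in the
critical norm — census item (I) of evidence #42 on ⟨20420⟩ (hand leafhand-4 g18), the viscous twin of the inviscid
`BlowupRigidityOne.CriticalRate` (⟨20206⟩):

* `critical_rate_lower_bound_visc` — clause form, general `m`, `|α| ≤ M_α`, `ν ≥ 0`: weight-10 blow-up at `T` ⟹ at every `s < T`,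
  for every `L` with `L·m²M_α(3+Λ)(T−s) < 1`, some mode has `(1+ε₀)^{5k/2}|X_{i,k}(s)| > L` (Riccati comparison
  `critical_le_riccati_visc` + BKM `weight10_le_exp_of_critical_bound_visc`);
* `critical_rate_of_blowsUpAt` — **in the skeleton's vocabulary**: `ViscousUpTo ε₀ ν α X₀ X t⋆ ∧ BlowsUpAt ε₀ X t⋆`, `α ∈ InTableClass R`
  ⟹ `sup_{i,k} Λ^k|X_{i,k}(t)| ≥ 1/(16(3+Λ)(t⋆−t))` at every `t < t⋆` (restricted table, `M_α = 1`, `m = 4`);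
* `not_blowsUpAt_of_critical_small` — **the regularity criterion**: critical amplitudes `≤ L` at time `t` with `L·16(3+Λ)(t⋆−t) < 1`
  ⟹ no blow-up at `t⋆` («`t⋆ − t ≥ 1/(16(3+Λ) sup_k Λ^k‖X_k(t)‖)`»);
* `typeOne_quantity_lower_bound` — **non-degeneracy of the renormalised trajectory**: some mode has `Λ^k|X_{i,k}(t)|(t⋆−t) ≥ 1/(32(3+Λ))`
  at every `t < t⋆`, so under `TypeOne` the renormalised trajectory lives in the shell `1/(32(3+Λ)) ≤ sup ≤ C` and no ω-limit of it
  is trivial in sup-norm;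
* `critical_unbounded_of_blowsUpAt` — the weight-10 blow-up is a blow-up of the critical amplitude.
READING for ⟨20420⟩: of g18's remaining list for (ω4) — (I) regularity criterion [this file], (II) front sharpness at level-reaching
times, (III) rise-phase action, (IV) ClockedFrames composition — item (I) is now a tree theorem; (II)–(IV) (and the WAKE-CALMING input
of evidence #38) remain.  HONEST LABEL: (ω3), (ω4), ⟨20420⟩, the Target and every NS statement remain OPEN; rung 0.
-/

noncomputable section

-- the summit and its single sub-problem share the name (CONVENTIONS §1)
set_option linter.dupNamespace false

open Set Filter Topology
open Literature.Analysis.FluidPDE Literature.Analysis.FluidPDE.TaoCascade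
open Summit.NavierStokesRegularity.NavierStokesRegularity.Theorems.BlowupRigidityOne
open Summit.NavierStokesRegularity.NavierStokesRegularity.Theorems.EternalRigidityViscBddOne.Birth

namespace Summit.NavierStokesRegularity.NavierStokesRegularity.Theorems.EternalRigidityViscBddOne.CriticalRate

variable {m : ℕ}

/-! ### The minimal blow-up rate of the viscous lattice -/

/-- **THE VISCOUS BLOW-UP RATE IS AT LEAST TYPE I (clause form, general `m`).**  Structure constants bounded by `M_α`, `ε₀ > 0`,
`ν ≥ 0`, `C₁ = m² M_α (3 + Λ)`.  Along a regular trajectory of the exact `ν`-viscous lattice on `[0,T)` (clauses of `ViscousUpTo`) whose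
weight-10 norm is UNBOUNDED on `[0,T)` (the clause of `BlowsUpAt`), at every `s ∈ [0,T)` and for every `L` with `L·C₁(T−s) < 1` some
mode has `(1+ε₀)^{5k/2}|X_{i,k}(s)| > L` — i.e. `sup_{i,k} Λ^k|X_{i,k}(s)| ≥ 1/(C₁(T−s))`.  (Otherwise the Riccati comparison
`critical_le_riccati_visc` bounds the critical amplitudes up to `T`, and the BKM estimate `weight10_le_exp_of_critical_bound_visc` then
bounds the weight-10 norm up to `T`.)
[cite: Teschl2012, §2.6 (blow-up alternative and rate); Tao2016AveragedNS, §4 (4.8), Lemma 4.1 (4.5), the viscous equation before Thm. 4.2] -/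
theorem critical_rate_lower_bound_visc {ε₀ ν Mα T : ℝ} (hε : 0 < ε₀) (hν : 0 ≤ ν) (hMα : 0 ≤ Mα)
    {α : Fin m → Fin m → Fin m → ℤ × ℤ × ℤ → ℝ} (hα : ∀ i₁ i₂ i₃ μ, |α i₁ i₂ i₃ μ| ≤ Mα)
    {X : Fin m → ℤ → ℝ → ℝ} (hcd : ∀ i n, ContDiffOn ℝ 1 (X i n) (Ico 0 T))
    (hmot : ∀ i n t, 0 ≤ t → t < T → derivWithin (X i n) (Ici 0) t =
      quadTerm ε₀ α X i n t - ν * (1 + ε₀) ^ ((2 : ℝ) * n) * X i n t)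
    (hlow : ∀ i n t, n < 0 → 0 ≤ t → t < T → X i n t = 0)
    (hreg : ∀ T' : ℝ, 0 < T' → T' < T → ∃ M : ℝ, ∀ t : ℝ, 0 ≤ t → t ≤ T' →
      ∀ (i : Fin m) (n : ℤ), (1 + (1 + ε₀) ^ ((10 : ℝ) * n)) * |X i n t| ≤ M)
    (hunb : ∀ M : ℝ, ∃ t : ℝ, 0 ≤ t ∧ t < T ∧
      ∃ (i : Fin m) (n : ℤ), M < (1 + (1 + ε₀) ^ ((10 : ℝ) * n)) * |X i n t|) :
    ∀ s ∈ Ico (0 : ℝ) T, ∀ L : ℝ, L * ((m : ℝ) ^ 2 * Mα * (3 + bigLam ε₀) * (T - s)) < 1 →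
      ∃ (i : Fin m) (k : ℤ), L < (1 + ε₀) ^ ((5 : ℝ) * k / 2) * |X i k s| := by
  intro s hs L hL
  by_contra hcon
  push Not at hcon
  -- `hcon : ∀ i k, (1+ε₀)^{5k/2} |X i k s| ≤ L`
  obtain ⟨t₀, -, -, i₀, -, -⟩ := hunb 0
  set C₁ : ℝ := (m : ℝ) ^ 2 * Mα * (3 + bigLam ε₀) with hC₁def
  have hl0 : (0 : ℝ) < 1 + ε₀ := by linarith
  have hLam : 0 < bigLam ε₀ := bigLam_pos (by linarith)
  have hC₁0 : 0 ≤ C₁ := by positivity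
  have hL0 : 0 ≤ L := le_trans (mul_nonneg (Real.rpow_nonneg hl0.le _) (abs_nonneg _)) (hcon i₀ 0)
  have hTs : 0 < T - s := by linarith [hs.2]
  -- choose `θ > 0` with `(C₁ + θ)(L + θ)(T - s) < 1`
  have hθev : ∀ᶠ θ in 𝓝[>] (0 : ℝ), (C₁ + θ) * (L + θ) * (T - s) < 1 := by
    have hc : ContinuousAt (fun θ : ℝ => (C₁ + θ) * (L + θ) * (T - s)) 0 := by fun_prop
    have hlim : Tendsto (fun θ : ℝ => (C₁ + θ) * (L + θ) * (T - s)) (𝓝[>] 0)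
        (𝓝 ((C₁ + 0) * (L + 0) * (T - s))) := hc.tendsto.mono_left nhdsWithin_le_nhds
    refine hlim (Iio_mem_nhds ?_)
    simp only [add_zero]
    linarith [mul_comm L (C₁ * (T - s)), mul_assoc C₁ (T - s) L, mul_assoc C₁ L (T - s),
      mul_comm (T - s) L]
  obtain ⟨θ, hθ1, hθ⟩ := (hθev.and self_mem_nhdsWithin).exists
  have hθ : 0 < θ := hθ
  have hA : 0 < L + θ := by linarith
  have hgap : (C₁ + θ) * (L + θ) * (T - s) < 1 := hθ1
  have hAs : ∀ (i : Fin m) (k : ℤ), (1 + ε₀) ^ ((5 : ℝ) * k / 2) * |X i k s| ≤ L + θ :=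
    fun i k => (hcon i k).trans (by linarith)
  -- the uniform critical bound on `[s,T)`
  set A' : ℝ := (L + θ) / (1 - (C₁ + θ) * (L + θ) * (T - s)) with hA'def
  have hden : 0 < 1 - (C₁ + θ) * (L + θ) * (T - s) := by linarith
  have hA'0 : 0 ≤ A' := div_nonneg hA.le hden.le
  -- the weight-10 bound at time `s`
  obtain ⟨M₁, hM₁⟩ := hreg ((s + T) / 2) (by linarith [hs.1]) (by linarith [hs.2])
  set N : ℝ := max M₁ 0 with hNdef
  have hN0 : 0 ≤ N := le_max_right _ _
  have hNs : ∀ (i : Fin m) (k : ℤ), (1 + (1 + ε₀) ^ ((10 : ℝ) * k)) * |X i k s| ≤ N :=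
    fun i k => (hM₁ s hs.1 (by linarith [hs.2]) i k).trans (le_max_left _ _)
  -- the final weight-10 bound on `[0,T)`
  set Kc : ℝ := 2 * ((m : ℝ) ^ 2 * Mα * A' * (3 + (1 + ε₀) ^ (10 : ℝ))) + 1 with hKcdef
  have hKc0 : 0 ≤ Kc := by positivity
  set Mfin : ℝ := max N ((N + 1) * Real.exp (Kc * (T - s))) with hMfin
  have hall : ∀ τ, 0 ≤ τ → τ < T → ∀ (i : Fin m) (k : ℤ),
      (1 + (1 + ε₀) ^ ((10 : ℝ) * k)) * |X i k τ| ≤ Mfin := by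
    intro τ hτ0 hτT i k
    rcases le_or_gt τ s with hτs | hτs
    · exact ((hM₁ τ hτ0 (by linarith [hs.2]) i k).trans (le_max_left _ _)).trans (le_max_left _ _)
    · have hgapτ : (C₁ + θ) * (L + θ) * (τ - s) < 1 := by
        have : (C₁ + θ) * (L + θ) * (τ - s) ≤ (C₁ + θ) * (L + θ) * (T - s) :=
          mul_le_mul_of_nonneg_left (by linarith) (mul_pos (by linarith) hA).le
        linarith
      have hric := critical_le_riccati_visc hε hν hMα hα hcd hmot hlow hreg hs hA hAs
        (by linarith : C₁ < C₁ + θ) hτs.le hτT hgapτ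
      have hcrit : ∀ τ' ∈ Icc s τ, ∀ (j : Fin m) (k' : ℤ), (1 + ε₀) ^ ((5 : ℝ) * k' / 2) * |X j k' τ'| ≤ A' := by
        intro τ' hτ' j k'
        refine (hric τ' hτ' j k').trans ?_
        have hden' : 1 - (C₁ + θ) * (L + θ) * (T - s) ≤ 1 - (C₁ + θ) * (L + θ) * (τ' - s) := by
          have : (C₁ + θ) * (L + θ) * (τ' - s) ≤ (C₁ + θ) * (L + θ) * (T - s) :=
            mul_le_mul_of_nonneg_left (by linarith [hτ'.2]) (mul_pos (by linarith) hA).le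
          linarith
        exact div_le_div_of_nonneg_left hA.le hden hden'
      have hB := weight10_le_exp_of_critical_bound_visc hε hν hMα hA'0 hα hcd hmot hreg hs.1 hτs.le hτT hN0 hNs
        hcrit τ ⟨hτs.le, le_rfl⟩ i k
      refine hB.trans ((mul_le_mul_of_nonneg_left (Real.exp_le_exp.2
        (mul_le_mul_of_nonneg_left (by linarith) hKc0)) (by linarith)).trans (le_max_right _ _))
  obtain ⟨t, ht0, htT, i, n, hlt⟩ := hunb Mfin
  exact absurd (hall t ht0 htT i n) (not_le.2 hlt)

/-! ### In the registered vocabulary of crux `EternalRigidityViscBddOne` (`ViscousUpTo` / `BlowsUpAt` / `TypeOne`) -/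

/-- **MINIMAL BLOW-UP RATE of a viscous blow-up, in the skeleton's vocabulary.**  For a table of `InTableClass R` (`m = 4`), `ε₀ > 0`,
`ν > 0`: if `ViscousUpTo ε₀ ν α X₀ X t⋆` and `BlowsUpAt ε₀ X t⋆`, then at every `t ∈ [0,t⋆)` and for every `L` with
`L · 16(3+Λ)(t⋆−t) < 1` some mode has `(1+ε₀)^{5k/2}|X_{i,k}(t)| > L`: `sup_{i,k} Λ^k |X_{i,k}(t)| ≥ 1/(16(3+Λ)(t⋆−t))`
(`Λ = bigLam ε₀`; the table is replaced by its restriction to the shift set, bounded by `1`, which drives the same nonlinearity).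
[cite: Teschl2012, §2.6; Tao2016AveragedNS, §4 (4.8), Lemma 4.1 (4.5), the viscous equation before Thm. 4.2; cell vocabulary (stmt-NavierStokesRegularity-20420)] -/
theorem critical_rate_of_blowsUpAt {R ε₀ ν : ℝ} (hε₀ : 0 < ε₀) (hν : 0 < ν)
    {α : Fin 4 → Fin 4 → Fin 4 → ℤ × ℤ × ℤ → ℝ} (hα : InTableClass R α) {X₀ : Fin 4 → ℝ}
    {X : Fin 4 → ℤ → ℝ → ℝ} {tStar : ℝ} (hV : ViscousUpTo ε₀ ν α X₀ X tStar) (hB : BlowsUpAt ε₀ X tStar) :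
    ∀ t : ℝ, 0 ≤ t → t < tStar → ∀ L : ℝ, L * (16 * (3 + bigLam ε₀) * (tStar - t)) < 1 →
      ∃ (i : Fin 4) (k : ℤ), L < (1 + ε₀) ^ ((5 : ℝ) * k / 2) * |X i k t| := by
  intro t ht0 htT L hL
  have hα' := abs_restrictShiftSet_le zero_le_one (abs_le_one_of_inTableClass hα)
  have hmot' : ∀ i n t, 0 ≤ t → t < tStar → derivWithin (X i n) (Ici 0) t =
      quadTerm ε₀ (restrictShiftSet α) X i n t - ν * (1 + ε₀) ^ ((2 : ℝ) * n) * X i n t := by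
    intro i n t ht htT'
    rw [quadTerm_restrictShiftSet]
    exact hV.motion i n t ht htT'
  have hreg : ∀ T' : ℝ, 0 < T' → T' < tStar → ∃ M : ℝ, ∀ t : ℝ, 0 ≤ t → t ≤ T' →
      ∀ (i : Fin 4) (n : ℤ), (1 + (1 + ε₀) ^ ((10 : ℝ) * n)) * |X i n t| ≤ M := by
    intro T' h1 h2
    obtain ⟨M, hM⟩ := hV.apriori T' h1 h2
    exact ⟨M, fun t ht0' htT' i n => hM t ⟨ht0', htT'⟩ i n⟩
  have hL' : L * (((4 : ℕ) : ℝ) ^ 2 * 1 * (3 + bigLam ε₀) * (tStar - t)) < 1 := by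
    norm_num
    linarith
  exact critical_rate_lower_bound_visc hε₀ hν.le zero_le_one hα' hV.contDiffOn hmot' hV.noLow hreg hB
    t ⟨ht0, htT⟩ L hL'

/-- **REGULARITY CRITERION in the critical norm (remaining lemma (I) of the (ω4) census of ⟨20420⟩).**  If at some time `t < t⋆` every
critical amplitude of a regular `ν`-trajectory satisfies `(1+ε₀)^{5k/2}|X_{i,k}(t)| ≤ L` with `L · 16(3+Λ)(t⋆ − t) < 1`, then the
trajectory does NOT blow up at `t⋆` — equivalently a blow-up at `t⋆` forces `t⋆ − t ≥ 1/(16(3+Λ)·sup_{i,k} Λ^k|X_{i,k}(t)|)` at every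
earlier time.  MODEL lattice only.
[cite: Teschl2012, §2.6; Tao2016AveragedNS, §4 (4.8), Lemma 4.1 (4.5), the viscous equation before Thm. 4.2; cell vocabulary (stmt-NavierStokesRegularity-20420)] -/
theorem not_blowsUpAt_of_critical_small {R ε₀ ν : ℝ} (hε₀ : 0 < ε₀) (hν : 0 < ν)
    {α : Fin 4 → Fin 4 → Fin 4 → ℤ × ℤ × ℤ → ℝ} (hα : InTableClass R α) {X₀ : Fin 4 → ℝ}
    {X : Fin 4 → ℤ → ℝ → ℝ} {tStar : ℝ} (hV : ViscousUpTo ε₀ ν α X₀ X tStar) {t L : ℝ} (ht0 : 0 ≤ t)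
    (htT : t < tStar) (hsmall : ∀ (i : Fin 4) (k : ℤ), (1 + ε₀) ^ ((5 : ℝ) * k / 2) * |X i k t| ≤ L)
    (hL : L * (16 * (3 + bigLam ε₀) * (tStar - t)) < 1) : ¬ BlowsUpAt ε₀ X tStar := by
  intro hB
  obtain ⟨i, k, hlt⟩ := critical_rate_of_blowsUpAt hε₀ hν hα hV hB t ht0 htT L hL
  exact absurd (hsmall i k) (not_le.2 hlt)

/-- **NON-DEGENERACY OF THE RENORMALISED VISCOUS BLOW-UP TRAJECTORY.**  Along a viscous blow-up (`ViscousUpTo ∧ BlowsUpAt`, table of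
`InTableClass R`, `ν > 0`) the TYPE-I QUANTITY of the skeleton is bounded BELOW at every time: some mode has
`Λ^k |X_{i,k}(t)| (t⋆ − t) ≥ 1/(32(3+Λ))` (`Λ^k = bigLam ε₀ ^ k = (1+ε₀)^{5k/2}`).  With `TypeOne` (the upper bound `≤ C`) this pins
the renormalised trajectory `W_n(σ) = Λ^n e^{−σ} X_n(t⋆ − e^{−σ})` inside the shell `1/(32(3+Λ)) ≤ sup_n ‖W_n(σ)‖_∞ ≤ C` at every
log-time, so no ω-limit of it (stub (ω4) `stub_eternalLimitViscBdd`) can vanish in sup-norm.  MODEL lattice only.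
[cite: Tao2016AveragedNS, §4 (4.1), §6.4 (self-similar variables); Teschl2012, §2.6; cell vocabulary (stmt-NavierStokesRegularity-20420)] -/
theorem typeOne_quantity_lower_bound {R ε₀ ν : ℝ} (hε₀ : 0 < ε₀) (hν : 0 < ν)
    {α : Fin 4 → Fin 4 → Fin 4 → ℤ × ℤ × ℤ → ℝ} (hα : InTableClass R α) {X₀ : Fin 4 → ℝ}
    {X : Fin 4 → ℤ → ℝ → ℝ} {tStar : ℝ} (hV : ViscousUpTo ε₀ ν α X₀ X tStar) (hB : BlowsUpAt ε₀ X tStar) :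
    ∀ t : ℝ, 0 ≤ t → t < tStar →
      ∃ (i : Fin 4) (k : ℤ), 1 / (32 * (3 + bigLam ε₀)) ≤ bigLam ε₀ ^ k * |X i k t| * (tStar - t) := by
  intro t ht0 htT
  have hl0 : (0 : ℝ) < 1 + ε₀ := by linarith
  have hLam : 0 < bigLam ε₀ := bigLam_pos (by linarith)
  have hTt : 0 < tStar - t := by linarith
  have h3 : 0 < 32 * (3 + bigLam ε₀) * (tStar - t) := by positivity
  set L : ℝ := 1 / (32 * (3 + bigLam ε₀) * (tStar - t)) with hLdef
  have hL : L * (16 * (3 + bigLam ε₀) * (tStar - t)) < 1 := by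
    rw [hLdef, div_mul_eq_mul_div, one_mul, div_lt_one h3]
    nlinarith
  obtain ⟨i, k, hlt⟩ := critical_rate_of_blowsUpAt hε₀ hν hα hV hB t ht0 htT L hL
  refine ⟨i, k, ?_⟩
  have hP : (1 + ε₀) ^ ((5 : ℝ) * k / 2) = bigLam ε₀ ^ k := by
    rw [bigLam, ← Real.rpow_intCast, ← Real.rpow_mul hl0.le]
    congr 1
    ring
  rw [hP] at hlt
  have hLT : L * (tStar - t) = 1 / (32 * (3 + bigLam ε₀)) := by
    rw [hLdef]
    field_simp
  calc 1 / (32 * (3 + bigLam ε₀)) = L * (tStar - t) := hLT.symm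
    _ ≤ bigLam ε₀ ^ k * |X i k t| * (tStar - t) := mul_le_mul_of_nonneg_right hlt.le hTt.le

/-- **A viscous blow-up is a blow-up of the CRITICAL amplitude** (the viscous analogue of
`BlowupRigidityOne.critical_unbounded_of_maximalExactFlow`): `ViscousUpTo ∧ BlowsUpAt` (table of `InTableClass R`, `ν > 0`) ⟹ the
critical amplitude `sup_{i,k} (1+ε₀)^{5k/2}|X_{i,k}(t)|` is unbounded on `[0,t⋆)` — the weight-10 blow-up detected by the skeleton is a
blow-up in the type-I quantity of its extraction stub.  MODEL lattice only.
[cite: Teschl2012, §2.6; Tao2016AveragedNS, §4 (4.8), Lemma 4.1 (4.5); cell vocabulary (stmt-NavierStokesRegularity-20420)] -/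
theorem critical_unbounded_of_blowsUpAt {R ε₀ ν : ℝ} (hε₀ : 0 < ε₀) (hν : 0 < ν)
    {α : Fin 4 → Fin 4 → Fin 4 → ℤ × ℤ × ℤ → ℝ} (hα : InTableClass R α) {X₀ : Fin 4 → ℝ}
    {X : Fin 4 → ℤ → ℝ → ℝ} {tStar : ℝ} (hV : ViscousUpTo ε₀ ν α X₀ X tStar) (hB : BlowsUpAt ε₀ X tStar) :
    ∀ L : ℝ, ∃ t : ℝ, 0 ≤ t ∧ t < tStar ∧
      ∃ (i : Fin 4) (k : ℤ), L < (1 + ε₀) ^ ((5 : ℝ) * k / 2) * |X i k t| := by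
  intro L
  have hLam : 0 < bigLam ε₀ := bigLam_pos (by linarith)
  have hT : 0 < tStar := hV.pos
  set c : ℝ := 16 * (3 + bigLam ε₀) with hcdef
  have hc : 0 < c := by rw [hcdef]; positivity
  set d : ℝ := 1 / (2 * c * (|L| + 1)) with hddef
  have hd : 0 < d := by rw [hddef]; positivity
  set t : ℝ := max 0 (tStar - d) with htdef
  have ht0 : 0 ≤ t := le_max_left _ _
  have htT : t < tStar := max_lt hT (by linarith)
  have hTt : tStar - t ≤ d := by
    have : tStar - d ≤ t := le_max_right _ _
    linarith
  have hL : L * (c * (tStar - t)) < 1 := by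
    have h1 : L * (c * (tStar - t)) ≤ |L| * (c * (tStar - t)) :=
      mul_le_mul_of_nonneg_right (le_abs_self L) (mul_nonneg hc.le (by linarith))
    have h2 : |L| * (c * (tStar - t)) ≤ |L| * (c * d) :=
      mul_le_mul_of_nonneg_left (mul_le_mul_of_nonneg_left hTt hc.le) (abs_nonneg L)
    have h3 : |L| * (c * d) < 1 := by
      rw [hddef]
      have hL1 : 0 < |L| + 1 := by positivity
      rw [show |L| * (c * (1 / (2 * c * (|L| + 1)))) = |L| / (2 * (|L| + 1)) by field_simp]
      rw [div_lt_one (by positivity)]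
      linarith [abs_nonneg L]
    linarith
  obtain ⟨i, k, hlt⟩ := critical_rate_of_blowsUpAt hε₀ hν hα hV hB t ht0 htT L (by rw [hcdef] at hL; linarith)
  exact ⟨t, ht0, htT, i, k, hlt⟩

end Summit.NavierStokesRegularity.NavierStokesRegularity.Theorems.EternalRigidityViscBddOne.CriticalRate

end
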